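import Summits.CriticalPhenomena.SAWScalingLimit.Theorems.SAWRenewalTightnessSubseqIdentificationTiltedProductCell
import Summits.CriticalPhenomena.SAWScalingLimit.Theorems.SAWRenewalTightnessSubseqIdentificationTiltedProductFrozen
import HarnessLib

/-!
# The tilted martingale identities (line `boundary-area-law`, RS5b′/T2, Π): the frozen interior estimate

Line `boundary-area-law` of the crux `SubseqIdentification` (stmt-CriticalPhenomena-0783), restriction
reshape (lead c4, r-c4-5), stub `stub_tiltedProductMartingale` (Π) = half of step (T2) of the tilted
[LSW] Theorem 6.5 (G. F. Lawler, O. Schramm, W. Werner, *Conformal restriction: the chordal case*,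
J. Amer. Math. Soc. **16** (2003), §5 (5.1)–(5.3) and Prop. 5.3). Sequel of `…TiltedProductCell`:
the interior term of the product cell of `Mⁿ · Lᵏ` (`Mⁿ = imgMartK κ hA hne n`, `Lᵏ = locMartK κ α λ hA hne k`)
is `O(h√h)` in expectation (`exists_abs_integral_mul_prod_le`): for an `𝓕_u`-measurable weight `g ∈ [0, 1]`
supported on `{u < imgLocTimeK n}`, `|E[g · ΔW̃ · Ŷ′]| ≤ C h√h` with `C = C(κ, α, λ, n, R, t₁)` (`u ≤ t₁`).
Freeze the past at `u` (`integral_mul_eq_integral_mul_concat_of_integrable`, the functional being dominated by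
the integrable envelope of `ΔW̃`); on the support of `g` the past is alive with `A_u − W_u` in the level-`n`
controlled class and driver bounded by `n + 1`, so the frozen conditional mean is
`O(h√h)` by `exists_abs_integral_frozenProd_le` (`…TiltedProductFrozen`: the first-order coefficient
`κ/2 − 3 + κα` vanishes — in print `d⟨W̃, Ỹ⟩ + Ỹ · (drift of W̃) = Ỹ h″ (κα + κ/2 − 3) dt = 0`), uniformly on the
class (`imageStepC_le_of_abs_le`).

References: [LSW] §5 (5.1)–(5.3), Prop. 5.3. No named fact is used.
-/

noncomputable section

open MeasureTheory Filter Topology Set Metric Function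
open scoped NNReal ENNReal
open Literature.Probability.RandomPlanarGeometry
open Literature.Probability.Process (preWienerMeasure runSup runSup_nonneg integrable_runSup)

namespace Summit.CriticalPhenomena.SAWScalingLimit.Theorems.SubseqIdentification.BoundaryAreaLaw

open Loewner PathOps

/-! ### The frozen interior estimate -/

section Interior

variable [MeasurableSpace C(ℝ≥0, ℝ)] [BorelSpace C(ℝ≥0, ℝ)]
variable {κ : ℝ≥0} {α lam : ℝ} {A : Set ℂ}

/-- **The interior term of the product cell is `O(h√h)` in expectation** ([LSW] §5, one step, frozen past):
for `A ⊆ B̄(0, R)` and a horizon `t₁` there is `C = C(κ, α, λ, n, R, t₁) ≥ 0` such that for `u ≤ t₁`,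
`0 < h ≤ 3c₀²/256` (`c₀ = (cₙ/2)(cₙ/16)/4000`), `λ h · massBdCell n ≤ 1`, and every `𝓕_u`-measurable
weight `g : Ω → [0, 1]` supported on `{u < imgLocTimeK n}`,

  `|E[g · ΔW̃ · Ŷ′]| ≤ C h √h`.

Freeze the past at `u` (`integral_mul_eq_integral_mul_concat_of_integrable`, the functional being
dominated by the integrable envelope of `ΔW̃`); on the support of `g` the past is alive with `A_u − W_u` in
the level-`n` class and driver bounded by `n + 1`, so the frozen conditional mean is
`O(h√h)` by `exists_abs_integral_frozenProd_le`, uniformly (`imageStepC_le_of_abs_le`). [cite: LawlerSchrammWerner2003Restriction, §5 (5.1)–(5.3) and Prop. 5.3] -/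
theorem exists_abs_integral_mul_prod_le (hκ0 : 0 < κ) (hκ : κ ≤ 8 / 3) (hαdef : α = (6 - κ) / (2 * κ))
    (hlamdef : lam = (8 - 3 * κ) * (6 - κ) / (2 * κ)) (hA : IsStarHull A) (hne : A.Nonempty) (n : ℕ) {R : ℝ}
    (hR0 : 0 < R) (hAR : A ⊆ closedBall (0 : ℂ) R) (t₁ : ℝ≥0) :
    ∃ C : ℝ, 0 ≤ C ∧ ∀ (u h : ℝ≥0), u ≤ t₁ → 0 < h →
      (h : ℝ) ≤ 3 * (locLevel n / 2 * (locLevel n / 16) / 4000) ^ 2 / 256 → lam * (h * massBdCell n) ≤ 1 →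
      ∀ {g : (ℝ≥0 → ℝ) → ℝ}, Measurable[brownianFiltration u] g → (∀ ω, g ω ∈ Icc (0 : ℝ) 1) →
        (∀ ω, g ω ≠ 0 → (u : WithTop ℝ≥0) < imgLocTimeK κ hA hne n ω) →
        |∫ ω, g ω * ((imageDrvFnK κ A (u + h) (brownianCPath ω) - imageDrvFnK κ A u (brownianCPath ω)) *
            (DFnK κ A (u + h) (brownianCPath ω) ^ α * Real.exp (-(lam * JFnK κ A u h (brownianCPath ω)))))
            ∂preWienerMeasure| ≤ C * h * Real.sqrt h := by
  haveI := isProbabilityMeasure_preWienerMeasure'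
  obtain ⟨hαpos, hlam0⟩ := exponents_pos hκ hαdef hlamdef hκ0
  obtain ⟨hc0, hc1⟩ := locLevel_pos_le n
  set c := locLevel n with hc
  set δ₀ : ℝ := c / 2 with hδ₀def
  set ρ₀ : ℝ := c / 16 with hρ₀def
  have hδ0 : 0 < δ₀ := by positivity
  have hρ₀ : 0 < ρ₀ := by positivity
  have hρ1 : ρ₀ ≤ 1 := by rw [hρ₀def]; linarith
  have hκr : (0 : ℝ) ≤ κ := κ.coe_nonneg
  have hs0 : 0 ≤ Real.sqrt κ := Real.sqrt_nonneg _
  -- the constant of the frozen first moment (product expansion)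
  obtain ⟨K, hK0, hK⟩ := exists_abs_integral_frozenProd_le hκ0 hκ hαdef hlamdef hA hne hR0 hAR hδ0 hρ₀ hρ1
  -- the uniform constant
  set cc : ℝ := δ₀ * ρ₀ / 4000 * (Real.sqrt κ / stepSigma) with hcc
  set p : ℝ := 128 * κ ^ 2 / cc ^ 4 with hp
  set j : ℝ := (1 + 2 * α) / ρ₀ with hj
  set M₁ : ℝ := 3482 * Real.sqrt κ with hM₁
  set M₀' : ℝ := (3482 * ((n : ℝ) + 1) + (15080 * Real.sqrt ((t₁ : ℝ) + 1) + 1160 * R) + 6 * α / ρ₀) with hM₀'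
  have hp0 : 0 ≤ p := by positivity
  have hj0 : 0 ≤ j := by positivity
  have hM₀'0 : 0 ≤ M₀' := by positivity
  refine ⟨(K * (3 * Real.sqrt κ + 5 + 2 * κ * Real.sqrt κ) + 3 * j * p + 2 * M₁ * Real.sqrt p + Real.sqrt κ * Real.sqrt p +
      j * κ * Real.sqrt p) + p * M₀', by positivity, ?_⟩
  intro u h hut hh0 hh hlamh g hgm hg01 hsupp
  have hh1 : (h : ℝ) ≤ 1 := by
    have h1 : 3 * (locLevel n / 2 * (locLevel n / 16) / 4000) ^ 2 / 256 ≤ 1 := by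
      have : locLevel n / 2 * (locLevel n / 16) / 4000 ≤ 1 := by
        rw [div_le_one (by norm_num)]; nlinarith
      have h2 : 0 ≤ locLevel n / 2 * (locLevel n / 16) / 4000 := by positivity
      nlinarith
    exact hh.trans h1
  have hhs0 : 0 ≤ (h : ℝ) * Real.sqrt h := by positivity
  -- the functional and its integrability along the Brownian path
  set Φ : C(ℝ≥0, ℝ) → ℝ := fun υ ↦ (imageDrvFnK κ A (u + h) υ - imageDrvFnK κ A u υ) *
    (DFnK κ A (u + h) υ ^ α * Real.exp (-(lam * JFnK κ A u h υ))) with hΦ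
  obtain ⟨hΔm, iΔ, -⟩ := integrable_imageDrv_subK (κ := κ) hA hne hR0 hAR u h
  have hYm : Measurable fun υ : C(ℝ≥0, ℝ) ↦ DFnK κ A (u + h) υ ^ α * Real.exp (-(lam * JFnK κ A u h υ)) :=
    ((measurable_DFnK hA hne (u + h)).pow_const _).mul ((measurable_JFnK hA hne u h).const_mul lam).neg.exp
  have hY01 : ∀ υ, 0 ≤ DFnK κ A (u + h) υ ^ α * Real.exp (-(lam * JFnK κ A u h υ)) ∧
      DFnK κ A (u + h) υ ^ α * Real.exp (-(lam * JFnK κ A u h υ)) ≤ 1 := fun υ ↦ by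
    obtain ⟨-, -, e0, e1⟩ := DFnK_eq (κ := κ) (A := A) (u + h) υ
    have c1 : Real.exp (-(lam * JFnK κ A u h υ)) ≤ 1 := by
      rw [Real.exp_le_one_iff, neg_nonpos]; exact mul_nonneg hlam0 (JFnK_nonneg hA u h _)
    exact ⟨mul_nonneg (Real.rpow_nonneg e0 _) (Real.exp_pos _).le,
      mul_le_one₀ (Real.rpow_le_one e0 e1 hαpos.le) (Real.exp_pos _).le c1⟩
  have hΦm : Measurable Φ := hΔm.mul hYm
  have hΦi : Integrable (fun ω ↦ Φ (brownianCPath ω)) preWienerMeasure := by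
    refine iΔ.abs.mono' (hΦm.comp measurable_brownianCPath).aestronglyMeasurable (Eventually.of_forall fun ω ↦ ?_)
    rw [Real.norm_eq_abs, hΦ]; simp only
    rw [abs_mul, abs_of_nonneg (hY01 _).1]
    exact mul_le_of_le_one_right (abs_nonneg _) (hY01 _).2
  -- freezing
  obtain ⟨iΘ, hfr⟩ := integral_mul_eq_integral_mul_concat_of_integrable hgm hg01 hΦm hΦi
  rw [hfr]
  have hgm' : Measurable g := hgm.mono (brownianFiltration.le u) le_rfl
  have hg1 : ∀ ω, |g ω| ≤ 1 := fun ω ↦ by rw [abs_of_nonneg (hg01 ω).1]; exact (hg01 ω).2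
  have hg1' : ∀ᵐ ω ∂preWienerMeasure, ‖g ω‖ ≤ 1 := Eventually.of_forall fun ω ↦ by rw [Real.norm_eq_abs]; exact hg1 ω
  have igΘ := iΘ.bdd_mul hgm'.aestronglyMeasurable hg1'
  -- the pointwise bound of the frozen conditional mean on the support of `g`
  have hpt : ∀ ω, |g ω * ∫ ω₂, Φ (concat u (stop u (brownianCPath ω), brownianCPath ω₂)) ∂preWienerMeasure| ≤
      ((K * (3 * Real.sqrt κ + 5 + 2 * κ * Real.sqrt κ) + 3 * j * p + 2 * M₁ * Real.sqrt p + Real.sqrt κ * Real.sqrt p +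
        j * κ * Real.sqrt p) + p * M₀') * h * Real.sqrt h := by
    intro ω
    by_cases hg0 : g ω = 0
    · rw [hg0, zero_mul, abs_zero]; positivity
    have hu := hsupp ω hg0
    obtain ⟨halive, -, -, hd, hm⟩ := controlled_of_lt_locTimeK (lt_of_lt_of_le hu (imgLocTimeK_le_locTimeK n ω))
    set B := slidHull (drvK κ (brownianCPath ω)) A u with hBdef
    have hB : IsStarHull B := Loewner.isStarHull_slidHull_of_disjoint (continuous_drvK κ _) hA halive
    have hδ : 2 * δ₀ ≤ starDeriv B := by rw [hδ₀def]; linarith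
    have hBρ : Disjoint (ball (0 : ℂ) (16 * ρ₀)) B := by
      rw [hρ₀def, show 16 * (c / 16) = c by ring]
      exact disjoint_ball_infDist.mono_left (ball_subset_ball hm.le)
    have hBρ8 : Disjoint (ball (0 : ℂ) (8 * ρ₀)) B := hBρ.mono_left (ball_subset_ball (by linarith))
    have hN0 : (0 : ℝ) ≤ (n : ℝ) + 1 := by positivity
    have hN : ∀ s : ℝ≥0, s ≤ u → |drvK κ (brownianCPath ω) s| ≤ (n : ℝ) + 1 := fun s hs ↦
      abs_drvK_le_of_le_imgLocTimeK ((WithTop.coe_le_coe.2 hs).trans hu.le)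
    have key := hK halive hBρ hδ hh0 hh hN0 hN hlamh
    -- uniformity of the constant
    obtain ⟨hd0, hd1, -⟩ := starDeriv_spec hB
    obtain ⟨-, -, hc2, -, -⟩ := starJet_spec hB hρ₀ hBρ8
    have hy0 : 0 ≤ starDeriv B ^ α := Real.rpow_nonneg hd0.le _
    have hy1 : starDeriv B ^ α ≤ 1 := Real.rpow_le_one hd0.le hd1 hαpos.le
    have hd' : |starDeriv B * starDeriv B ^ α| ≤ 1 := by
      rw [abs_mul, abs_of_pos hd0, abs_of_nonneg hy0]; exact mul_le_one₀ hd1 hy0 hy1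
    have hc₂' : |starDeriv B ^ α * starJet2 B * (1 + 2 * α)| ≤ j := by
      rw [abs_mul, abs_mul, abs_of_nonneg hy0, abs_of_nonneg (by positivity : (0 : ℝ) ≤ 1 + 2 * α), hj]
      calc starDeriv B ^ α * |starJet2 B| * (1 + 2 * α) ≤ 1 * (1 / ρ₀) * (1 + 2 * α) :=
            mul_le_mul_of_nonneg_right (mul_le_mul hy1 hc2 (abs_nonneg _) zero_le_one) (by positivity)
        _ = (1 + 2 * α) / ρ₀ := by ring
    have m1 := imageStepC_le_of_abs_le (κ := (κ : ℝ)) (c := cc) (K := K)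
      (M₀ := (3482 * ((n : ℝ) + 1) + (15080 * Real.sqrt ((u + h : ℝ≥0) : ℝ) + 1160 * R) + 6 * α / ρ₀)) (M₁ := M₁) hκr hd' hc₂'
    have hsq : Real.sqrt ((u + h : ℝ≥0) : ℝ) ≤ Real.sqrt ((t₁ : ℝ) + 1) :=
      Real.sqrt_le_sqrt (by push_cast; exact add_le_add (by exact_mod_cast hut) hh1)
    have m2 : (3482 * ((n : ℝ) + 1) + (15080 * Real.sqrt ((u + h : ℝ≥0) : ℝ) + 1160 * R) + 6 * α / ρ₀) ≤ M₀' := by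
      rw [hM₀']; linarith [mul_le_mul_of_nonneg_left hsq (by norm_num : (0 : ℝ) ≤ 15080)]
    have m3 := mul_le_mul_of_nonneg_left m2 hp0
    rw [abs_mul]
    calc |g ω| * |∫ ω₂, Φ (concat u (stop u (brownianCPath ω), brownianCPath ω₂)) ∂preWienerMeasure|
        ≤ 1 * (imageStepC κ cc (starDeriv B * starDeriv B ^ α) (starDeriv B ^ α * starJet2 B * (1 + 2 * α)) K
            (3482 * ((n : ℝ) + 1) + (15080 * Real.sqrt ((u + h : ℝ≥0) : ℝ) + 1160 * R) + 6 * α / ρ₀) M₁ * h * Real.sqrt h) :=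
          mul_le_mul (hg1 ω) key (abs_nonneg _) zero_le_one
      _ ≤ _ := by
          rw [one_mul, mul_assoc, mul_assoc _ (h : ℝ)]
          exact mul_le_mul_of_nonneg_right (m1.trans (by linarith)) hhs0
  calc |∫ ω, g ω * ∫ ω₂, Φ (concat u (stop u (brownianCPath ω), brownianCPath ω₂)) ∂preWienerMeasure ∂preWienerMeasure|
      ≤ ∫ ω, |g ω * ∫ ω₂, Φ (concat u (stop u (brownianCPath ω), brownianCPath ω₂)) ∂preWienerMeasure| ∂preWienerMeasure :=
        abs_integral_le_integral_abs
    _ ≤ ∫ _, ((K * (3 * Real.sqrt κ + 5 + 2 * κ * Real.sqrt κ) + 3 * j * p + 2 * M₁ * Real.sqrt p + Real.sqrt κ * Real.sqrt p +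
        j * κ * Real.sqrt p) + p * M₀') * h * Real.sqrt h ∂preWienerMeasure := integral_mono igΘ.abs (integrable_const _) hpt
    _ = _ := by simp

end Interior

section Registered

/-- **Registered form** (explicit binders) of `exists_abs_integral_mul_prod_le`: the interior term of the
product cell is `O(h√h)` in expectation, uniformly over `𝓕_u`-weights in `[0, 1]` supported on
`{u < imgLocTimeK n}`, `u ≤ t₁`. [cite: LawlerSchrammWerner2003Restriction, §5 (5.1)–(5.3) and Prop. 5.3] -/
theorem exists_abs_integral_mul_prod_le_registered :
    ∀ (κ : ℝ≥0) (α lam : ℝ), 0 < κ → κ ≤ 8 / 3 → α = (6 - κ) / (2 * κ) → lam = (8 - 3 * κ) * (6 - κ) / (2 * κ) →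
      ∀ (A : Set ℂ) (hA : IsStarHull A) (hne : A.Nonempty) (n : ℕ) (R : ℝ), 0 < R → A ⊆ closedBall (0 : ℂ) R →
      ∀ (t₁ : ℝ≥0), ∃ C : ℝ, 0 ≤ C ∧ ∀ (u h : ℝ≥0), u ≤ t₁ → 0 < h →
        (h : ℝ) ≤ 3 * (locLevel n / 2 * (locLevel n / 16) / 4000) ^ 2 / 256 → lam * (h * massBdCell n) ≤ 1 →
        ∀ (g : (ℝ≥0 → ℝ) → ℝ), Measurable[brownianFiltration u] g → (∀ ω, g ω ∈ Icc (0 : ℝ) 1) →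
          (∀ ω, g ω ≠ 0 → (u : WithTop ℝ≥0) < imgLocTimeK κ hA hne n ω) →
          |∫ ω, g ω * ((imageDrvFnK κ A (u + h) (brownianCPath ω) - imageDrvFnK κ A u (brownianCPath ω)) *
              (DFnK κ A (u + h) (brownianCPath ω) ^ α * Real.exp (-(lam * JFnK κ A u h (brownianCPath ω)))))
              ∂preWienerMeasure| ≤ C * h * Real.sqrt h := by
  intro κ α lam hκ0 hκ hαdef hlamdef A hA hne n R hR0 hAR t₁
  letI : MeasurableSpace C(ℝ≥0, ℝ) := borel _
  haveI : BorelSpace C(ℝ≥0, ℝ) := ⟨rfl⟩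
  obtain ⟨C, hC0, hC⟩ := exists_abs_integral_mul_prod_le hκ0 hκ hαdef hlamdef hA hne n hR0 hAR t₁
  exact ⟨C, hC0, fun u h hut hh0 hh hlamh g hgm hg01 hsupp ↦ hC u h hut hh0 hh hlamh hgm hg01 hsupp⟩

end Registered

end Summit.CriticalPhenomena.SAWScalingLimit.Theorems.SubseqIdentification.BoundaryAreaLaw

end
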